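import Literature.NumberTheory.Weil1964.FiniteWeilLevelFixing
import HarnessLib

/-!
# Level EIGENVECTORS of the finite Weil representation along a PROJECTIVELY continuous family

Topic `NumberTheory/Weil1964`; namespace `Literature.NumberTheory.Weil1964`.  KERNEL only (theorems over the tree's
`AdelicMetaplecticThetaMajorants` §5 and `FiniteWeilLevelFixing`; no definition, no named fact, no `sorry`).

[Weil1964, Chap. III n° 37–39]: the metaplectic group `Mp(X)_A` acts continuously on `𝒮(X_A)`; the standard function of a
lattice is an EIGENVECTOR of the operators over the stabiliser of the lattice ([Weil1964, Chap. I n° 11, n° 16–19]: `𝐫(σ)` is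
determined by `σ` up to a scalar factor `t ∈ T`).  [GelbartRogawski1991, §3.1 p. 454]: the Weil representation restricted to the
unitary group along a splitting is smooth.  The tree's `FiniteWeilLevelFixing` proves the latter for a CONTINUOUS
`s : H → Mp_ψ(W_𝔸)ᶜᵒⁿᵗ`.  THIS FILE observes that the lattice-rigidity engine
(`eventually_forall_finSchrodinger_act_indicatorSB`) only uses the continuity of the SYMPLECTIC PROJECTIONS `h ↦ π(s h)·w`
(orbit maps on `W_𝔸`), and derives, for ANY map / homomorphism `s` into `Mp_ψ(W_𝔸)ᶜᵒⁿᵗ` whose projection `π ∘ s` is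
orbit-continuous (e.g. a bare COMPATIBLE splitting of a dual pair: `π ∘ s = ι` is the continuous symplectic embedding, while `s`
itself need not be continuous — it is pinned only up to a possibly discontinuous character into `ker π`):

* §1 `eventually_implementer_indicatorSB_eq_smul_of_proj`, `eventually_implementer_finTranslateSB_indicatorSB_eq_smul_of_proj` —
  near `1`, EVERY finite implementer `M_f` of `π(s h)` has `M_f 𝟙_{x₀+L} = (M_f 𝟙_L)(0) · 𝟙_{x₀+L}` (the SAME scalar for every coset);
* §2 `eventually_finRepMp_cosetIndicatorSB_eq_smul_of_proj` — the same for the finite factor `ω_f = finRepMp s` of a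
  homomorphism `s` fixing the archimedean vectors;
* §3 on the finite-adelic unitary group `H = U(J)(𝔸_{E,f})` (the `K_{U,f}(𝔪)` form a basis of neighbourhoods of `1`,
  `UnitaryGroup.exists_finCongruenceLevel_subset`): **`exists_finCongruenceLevel_forall_finRepMp_eq_smul_of_proj`** — every
  `v ∈ 𝒮((𝔸_F^∞)^ι)` is an EIGENVECTOR of `ω_f(k)` for all `k` in some principal congruence level `K_{U,f}(𝔪)`, `𝔪 ≠ 0`,
  with eigenvalue `c(k) = (ω_f(k) 𝟙_{𝔫𝒪̂^ι})(0)` (`𝔫` a level of `v`).  (For a continuous `s` the tree upgrades this to `c = 1`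
  by the absence of small subgroups in `ℂˣ`; for a bare `s` the eigenvalue is a possibly discontinuous character, of modulus `1`
  as soon as `ω ∘ s` is `L²`-isometric — the use made of it by the E-2 desk of crux H413, `StubSW2` (ii).)

## References
* [Weil1964] A. Weil, *Sur certains groupes d'opérateurs unitaires*, Acta Math. 111 (1964), Chap. I n° 11, 16–19; Chap. III
  n° 37–39 pp. 188–190.
* [GelbartRogawski1991] S. Gelbart, J. Rogawski, Invent. Math. 105 (1991), §3.1 p. 454, Prop. 3.1.1 p. 455.
* [MoeglinVignerasWaldspurger1987] C. Mœglin, M.-F. Vignéras, J.-L. Waldspurger, LNM 1291 (1987), Chap. 2 I.3, II.1.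
-/

set_option autoImplicit false

noncomputable section

open scoped Matrix TensorProduct Topology SchwartzMap Classical

open NumberField NumberField.mixedEmbedding IsDedekindDomain Filter

namespace Literature.NumberTheory.Weil1964

open Literature.NumberTheory.Automorphic Literature.RepresentationTheory.HeisenbergGroup

variable {F : Type} [Field F] [NumberField F] {ι : Type} [Fintype ι] [DecidableEq ι]
  {T : Matrix ι ι (AdeleRing (𝓞 F) F)}

/-! ## §1 Lattice rigidity near `1` along a projectively continuous family -/

section Rigidity

variable {H : Type*} [Group H] [TopologicalSpace H] [IsTopologicalGroup H]

/-- **Lattice rigidity near `1`, projective form.** Let `s : H → Mp_ψ(W_𝔸)ᶜᵒⁿᵗ` be any map whose symplectic projections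
`h ↦ π(s h)` are ORBIT-CONTINUOUS (`hsc`), with `π(s 1) = 1` and `π(s h) π(s h⁻¹) = 1`, `T` invertible, `L` a compact open subgroup.
Then for `h` near `1` EVERY finite implementer `M_f` of `π(s h)` satisfies `M_f 𝟙_L = (M_f 𝟙_L)(0) 𝟙_L` — the tree's
`eventually_implementer_indicatorSB_eq_smul` with its continuity hypothesis weakened to what its proof uses.
[cite: Weil1964, Chap. III n° 37–39 pp. 188–190] -/
theorem eventually_implementer_indicatorSB_eq_smul_of_proj (hT : IsUnit T) (s : H → adelicMpCont F ι T)
    (hsc : ∀ w : (ι → AdeleRing (𝓞 F) F) × (ι → AdeleRing (𝓞 F) F), Continuous fun z : H =>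
      ((adelicMpCont.proj F ι T (s z) : symplecticGroup (polar (adelicForm F ι T))) :
        ((ι → AdeleRing (𝓞 F) F) × (ι → AdeleRing (𝓞 F) F)) ≃ₗ[AdeleRing (𝓞 F) F]
          ((ι → AdeleRing (𝓞 F) F) × (ι → AdeleRing (𝓞 F) F))) w)
    (hs1 : adelicMpCont.proj F ι T (s 1) = 1)
    (hsinv : ∀ h : H, adelicMpCont.proj F ι T (s h) * adelicMpCont.proj F ι T (s h⁻¹) = 1)
    (L : AddSubgroup (ι → FiniteAdeleRing (𝓞 F) F))
    (hLo : IsOpen (L : Set (ι → FiniteAdeleRing (𝓞 F) F)))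
    (hLc : IsCompact (L : Set (ι → FiniteAdeleRing (𝓞 F) F))) :
    ∀ᶠ h in 𝓝 (1 : H), ∀ Mf : FinSB F ι →ₗ[ℂ] FinSB F ι,
      (∀ η ∈ finHeisenberg T, ∀ Φ : piSchwartzBruhat F ι,
        adelicTensorEnd LinearMap.id Mf (adelicSchrodinger F ι T η Φ) =
          adelicSchrodinger F ι T
            ((ofSymplectic (polar (adelicForm F ι T)) (adelicMpCont.proj F ι T (s h))).act η)
            (adelicTensorEnd LinearMap.id Mf Φ)) →
      Mf (indicatorSB F ι L hLo hLc) =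
        ((Mf (indicatorSB F ι L hLo hLc) : FinSB F ι) : (ι → FiniteAdeleRing (𝓞 F) F) → ℂ) 0 •
          indicatorSB F ι L hLo hLc := by
  -- the family `z ↦ π(s z⁻¹)` is orbit-continuous with value `1` at `z = 1`
  have hg : ∀ w : (ι → AdeleRing (𝓞 F) F) × (ι → AdeleRing (𝓞 F) F), Continuous fun z : H =>
      ((adelicMpCont.proj F ι T (s z⁻¹) : symplecticGroup (polar (adelicForm F ι T))) :
        ((ι → AdeleRing (𝓞 F) F) × (ι → AdeleRing (𝓞 F) F)) ≃ₗ[AdeleRing (𝓞 F) F]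
          ((ι → AdeleRing (𝓞 F) F) × (ι → AdeleRing (𝓞 F) F))) w :=
    fun w => (hsc w).comp continuous_inv
  have h0 : adelicMpCont.proj F ι T (s (1 : H)⁻¹) = 1 := by simp only [inv_one, hs1]
  -- translations by `L`
  have hv1 : Continuous fun l : ι → FiniteAdeleRing (𝓞 F) F =>
      (piAdeleSplit F ι (0, l), (0 : ι → AdeleRing (𝓞 F) F)) :=
    ((piAdeleSplit F ι).continuous.comp (continuous_const.prodMk continuous_id)).prodMk continuous_const
  have hv1f : ∀ l : ι → FiniteAdeleRing (𝓞 F) F,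
      finIdem F • (piAdeleSplit F ι (0, l), (0 : ι → AdeleRing (𝓞 F) F)) =
        (piAdeleSplit F ι (0, l), (0 : ι → AdeleRing (𝓞 F) F)) := fun l => by
    rw [Prod.smul_mk, finIdem_smul_piAdeleSplit_zero, smul_zero]
  have hv1a : ∀ l ∈ (L : Set (ι → FiniteAdeleRing (𝓞 F) F)),
      piFinite F ι (piAdeleSplit F ι (0, l), (0 : ι → AdeleRing (𝓞 F) F)).1 ∈ L := fun l hl => by
    rwa [piFinite_piAdeleSplit]
  have hv1b : ∀ l ∈ (L : Set (ι → FiniteAdeleRing (𝓞 F) F)),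
      piFinite F ι (T *ᵥ (piAdeleSplit F ι (0, l), (0 : ι → AdeleRing (𝓞 F) F)).2) ∈ dualBox F ι L :=
    fun l _ => by
    rw [Matrix.mulVec_zero, piFinite_zero_vec]
    exact (dualBox F ι L).zero_mem
  have hv1c : ∀ l ∈ (L : Set (ι → FiniteAdeleRing (𝓞 F) F)),
      polar (adelicForm F ι T) (piAdeleSplit F ι (0, l), (0 : ι → AdeleRing (𝓞 F) F))
        (piAdeleSplit F ι (0, l), (0 : ι → AdeleRing (𝓞 F) F)) = 0 := fun l _ => by
    rw [polar_apply, map_zero]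
  have ev1 := eventually_forall_finSchrodinger_act_indicatorSB (T := T) hg h0 hv1 hv1f hLc L hLo hLc hv1a hv1b
    hv1c
  -- modulations by `L^♮`
  have hv2 : Continuous fun y : ι → FiniteAdeleRing (𝓞 F) F => ((0 : ι → AdeleRing (𝓞 F) F),
      ((hT.unit⁻¹ : (Matrix ι ι (AdeleRing (𝓞 F) F))ˣ) : Matrix ι ι (AdeleRing (𝓞 F) F)) *ᵥ
        piAdeleSplit F ι (0, y)) :=
    continuous_const.prodMk (continuous_const.matrix_mulVec
      ((piAdeleSplit F ι).continuous.comp (continuous_const.prodMk continuous_id)))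
  have hTinv : ∀ y : ι → FiniteAdeleRing (𝓞 F) F,
      T *ᵥ (((hT.unit⁻¹ : (Matrix ι ι (AdeleRing (𝓞 F) F))ˣ) : Matrix ι ι (AdeleRing (𝓞 F) F)) *ᵥ
        piAdeleSplit F ι (0, y)) = piAdeleSplit F ι (0, y) := fun y => by
    rw [Matrix.mulVec_mulVec, hT.mul_val_inv, Matrix.one_mulVec]
  have hv2f : ∀ y : ι → FiniteAdeleRing (𝓞 F) F,
      finIdem F • ((0 : ι → AdeleRing (𝓞 F) F),
        ((hT.unit⁻¹ : (Matrix ι ι (AdeleRing (𝓞 F) F))ˣ) : Matrix ι ι (AdeleRing (𝓞 F) F)) *ᵥ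
          piAdeleSplit F ι (0, y)) =
      ((0 : ι → AdeleRing (𝓞 F) F),
        ((hT.unit⁻¹ : (Matrix ι ι (AdeleRing (𝓞 F) F))ˣ) : Matrix ι ι (AdeleRing (𝓞 F) F)) *ᵥ
          piAdeleSplit F ι (0, y)) := fun y => by
    rw [Prod.smul_mk, smul_zero, ← Matrix.mulVec_smul, finIdem_smul_piAdeleSplit_zero]
  have hv2a : ∀ y ∈ (dualBox F ι L : Set (ι → FiniteAdeleRing (𝓞 F) F)),
      piFinite F ι ((0 : ι → AdeleRing (𝓞 F) F),
        ((hT.unit⁻¹ : (Matrix ι ι (AdeleRing (𝓞 F) F))ˣ) : Matrix ι ι (AdeleRing (𝓞 F) F)) *ᵥ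
          piAdeleSplit F ι (0, y)).1 ∈ L := fun y _ => by
    rw [piFinite_zero_vec]
    exact L.zero_mem
  have hv2b : ∀ y ∈ (dualBox F ι L : Set (ι → FiniteAdeleRing (𝓞 F) F)),
      piFinite F ι (T *ᵥ ((0 : ι → AdeleRing (𝓞 F) F),
        ((hT.unit⁻¹ : (Matrix ι ι (AdeleRing (𝓞 F) F))ˣ) : Matrix ι ι (AdeleRing (𝓞 F) F)) *ᵥ
          piAdeleSplit F ι (0, y)).2) ∈ dualBox F ι L := fun y hy => by
    rwa [hTinv, piFinite_piAdeleSplit]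
  have hv2c : ∀ y ∈ (dualBox F ι L : Set (ι → FiniteAdeleRing (𝓞 F) F)),
      polar (adelicForm F ι T)
        ((0 : ι → AdeleRing (𝓞 F) F),
          ((hT.unit⁻¹ : (Matrix ι ι (AdeleRing (𝓞 F) F))ˣ) : Matrix ι ι (AdeleRing (𝓞 F) F)) *ᵥ
            piAdeleSplit F ι (0, y))
        ((0 : ι → AdeleRing (𝓞 F) F),
          ((hT.unit⁻¹ : (Matrix ι ι (AdeleRing (𝓞 F) F))ˣ) : Matrix ι ι (AdeleRing (𝓞 F) F)) *ᵥ
            piAdeleSplit F ι (0, y)) = 0 := fun y _ => by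
    rw [polar_apply, map_zero, LinearMap.zero_apply]
  have ev2 := eventually_forall_finSchrodinger_act_indicatorSB (T := T) hg h0 hv2 hv2f
    (isCompact_dualBox L hLo hLc) L hLo hLc hv2a hv2b hv2c
  filter_upwards [ev1, ev2] with h h1 h2 Mf hMf
  exact implementer_indicatorSB_eq_smul hT L hLo hLc (hsinv h) hMf h1 h2


/-- **Projective rigidity on the coset indicators**: under the same hypotheses, for `h` near `1` every finite implementer `M_f`
of `π(s h)` satisfies `M_f 𝟙_{x₀+L} = (M_f 𝟙_L)(0) · 𝟙_{x₀+L}` — the SAME scalar for every coset `x₀ + L` (the tree's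
`eventually_implementer_finTranslateSB_indicatorSB_eq_smul`, continuity weakened to the projections).
[cite: Weil1964, Chap. III n° 37–39 pp. 188–190] -/
theorem eventually_implementer_finTranslateSB_indicatorSB_eq_smul_of_proj (hT : IsUnit T) (s : H → adelicMpCont F ι T)
    (hsc : ∀ w : (ι → AdeleRing (𝓞 F) F) × (ι → AdeleRing (𝓞 F) F), Continuous fun z : H =>
      ((adelicMpCont.proj F ι T (s z) : symplecticGroup (polar (adelicForm F ι T))) :
        ((ι → AdeleRing (𝓞 F) F) × (ι → AdeleRing (𝓞 F) F)) ≃ₗ[AdeleRing (𝓞 F) F]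
          ((ι → AdeleRing (𝓞 F) F) × (ι → AdeleRing (𝓞 F) F))) w)
    (hs1 : adelicMpCont.proj F ι T (s 1) = 1)
    (hsinv : ∀ h : H, adelicMpCont.proj F ι T (s h) * adelicMpCont.proj F ι T (s h⁻¹) = 1)
    (L : AddSubgroup (ι → FiniteAdeleRing (𝓞 F) F))
    (hLo : IsOpen (L : Set (ι → FiniteAdeleRing (𝓞 F) F)))
    (hLc : IsCompact (L : Set (ι → FiniteAdeleRing (𝓞 F) F))) (x₀ : ι → FiniteAdeleRing (𝓞 F) F) :
    ∀ᶠ h in 𝓝 (1 : H), ∀ Mf : FinSB F ι →ₗ[ℂ] FinSB F ι,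
      (∀ η ∈ finHeisenberg T, ∀ Φ : piSchwartzBruhat F ι,
        adelicTensorEnd LinearMap.id Mf (adelicSchrodinger F ι T η Φ) =
          adelicSchrodinger F ι T
            ((ofSymplectic (polar (adelicForm F ι T)) (adelicMpCont.proj F ι T (s h))).act η)
            (adelicTensorEnd LinearMap.id Mf Φ)) →
      Mf (finTranslateSB F ι (-x₀) (indicatorSB F ι L hLo hLc)) =
        ((Mf (indicatorSB F ι L hLo hLc) : FinSB F ι) : (ι → FiniteAdeleRing (𝓞 F) F) → ℂ) 0 •
          finTranslateSB F ι (-x₀) (indicatorSB F ι L hLo hLc) := by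
  filter_upwards [eventually_implementer_indicatorSB_eq_smul_of_proj hT s hsc hs1 hsinv L hLo hLc,
    eventually_finSchrodinger_act_ofVec_indicatorSB_eq_finTranslateSB (T := T) hsc hs1 L hLo hLc x₀] with h hA hB Mf hMf
  exact implementer_finTranslateSB_indicatorSB_eq_smul L hLo hLc x₀ hMf (hA Mf hMf) hB

end Rigidity

/-! ## §2 The finite factor `ω_f = finRepMp s` of a homomorphism with orbit-continuous projections -/

section FinRep

variable {H : Type*} [Group H] [TopologicalSpace H] [IsTopologicalGroup H]

/-- **Near `1`, `ω_f(h)` maps `𝟙_{x₀+𝔫𝒪̂^ι}` to `(ω_f(h) 𝟙_{𝔫𝒪̂^ι})(0) · 𝟙_{x₀+𝔫𝒪̂^ι}`** for a homomorphism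
`s : H →* Mp_ψ(W_𝔸)ᶜᵒⁿᵗ` whose symplectic projections fix the archimedean vectors (`harch`) and are orbit-continuous (`hsc`)
— no continuity of `s` itself. [cite: GelbartRogawski1991, §3.1 p. 454] [cite: Weil1964, Chap. III n° 37–39 pp. 188–190] -/
theorem eventually_finRepMp_cosetIndicatorSB_eq_smul_of_proj (hT : IsUnit T) (s : H →* adelicMpCont F ι T)
    (hsc : ∀ w : (ι → AdeleRing (𝓞 F) F) × (ι → AdeleRing (𝓞 F) F), Continuous fun z : H =>
      ((adelicMpCont.proj F ι T (s z) : symplecticGroup (polar (adelicForm F ι T))) :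
        ((ι → AdeleRing (𝓞 F) F) × (ι → AdeleRing (𝓞 F) F)) ≃ₗ[AdeleRing (𝓞 F) F]
          ((ι → AdeleRing (𝓞 F) F) × (ι → AdeleRing (𝓞 F) F))) w)
    (harch : ∀ (h : H) (a w : ι → mixedSpace F),
      (adelicMpCont.proj F ι T (s h)).1 (archVec F ι a, archVec F ι w) = (archVec F ι a, archVec F ι w))
    (x₀ : ι → FiniteAdeleRing (𝓞 F) F) (𝔫 : Ideal (𝓞 F)) :
    ∀ᶠ h in 𝓝 (1 : H), finRepMp hT s harch h (cosetIndicatorSB F ι x₀ 𝔫) =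
      ((finRepMp hT s harch h (indicatorSB F ι (piLevelIdeal F ι 𝔫) (isOpen_piLevelIdeal F 𝔫)
          (isCompact_piLevelIdeal F ι 𝔫)) : FinSB F ι) : (ι → FiniteAdeleRing (𝓞 F) F) → ℂ) 0 •
        cosetIndicatorSB F ι x₀ 𝔫 := by
  have hs1 : adelicMpCont.proj F ι T (s 1) = 1 :=
    (congrArg (adelicMpCont.proj F ι T) (map_one s)).trans (map_one _)
  have hsinv : ∀ h : H, adelicMpCont.proj F ι T (s h) * adelicMpCont.proj F ι T (s h⁻¹) = 1 := fun h =>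
    (map_mul (adelicMpCont.proj F ι T) (s h) (s h⁻¹)).symm.trans
      ((congrArg (adelicMpCont.proj F ι T)
        ((map_mul s h h⁻¹).symm.trans ((congrArg s (mul_inv_cancel h)).trans (map_one s)))).trans (map_one _))
  filter_upwards [eventually_implementer_finTranslateSB_indicatorSB_eq_smul_of_proj hT s hsc hs1 hsinv
    (piLevelIdeal F ι 𝔫) (isOpen_piLevelIdeal F 𝔫) (isCompact_piLevelIdeal F ι 𝔫) x₀] with h hh
  exact hh _ (finRepMp_implements hT s harch h)

end FinRep

/-! ## §3 On `U(J)(𝔸_{E,f})`: every vector is a level EIGENVECTOR -/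

section Unitary

variable {F₁ E : Type} [Field F₁] [Field E] [NumberField E] [Algebra F₁ E] {c : E ≃ₐ[F₁] E} {N : ℕ}
  {J : Matrix (Fin N) (Fin N) E}

/-- **One principal congruence level on which finitely many coset indicators are eigenvectors with a COMMON eigenvalue
function**: for a homomorphism `s : U(J)(𝔸_{E,f}) →* Mp_ψ(W_𝔸)ᶜᵒⁿᵗ` with orbit-continuous projections fixing the archimedean
vectors and a finite family of cosets `x₀(a) + 𝔫𝒪̂^ι` of ONE level `𝔫`, there is `𝔪 ≠ 0` with
`ω_f(k) 𝟙_{x₀(a)+𝔫𝒪̂^ι} = (ω_f(k) 𝟙_{𝔫𝒪̂^ι})(0) · 𝟙_{x₀(a)+𝔫𝒪̂^ι}` for all `a` and all `k ∈ K_{U,f}(𝔪)` (finite intersection of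
the eventual neighbourhoods, `UnitaryGroup.exists_finCongruenceLevel_subset`). [cite: GelbartRogawski1991, §3.1 p. 454] -/
theorem exists_finCongruenceLevel_forall_forall_finRepMp_cosetIndicatorSB_eq_smul_of_proj {A : Type*} [Finite A]
    (hT : IsUnit T) (s : UnitaryGroup.finAdelic F₁ E c N J →* adelicMpCont F ι T)
    (hsc : ∀ w : (ι → AdeleRing (𝓞 F) F) × (ι → AdeleRing (𝓞 F) F), Continuous fun z : UnitaryGroup.finAdelic F₁ E c N J =>
      ((adelicMpCont.proj F ι T (s z) : symplecticGroup (polar (adelicForm F ι T))) :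
        ((ι → AdeleRing (𝓞 F) F) × (ι → AdeleRing (𝓞 F) F)) ≃ₗ[AdeleRing (𝓞 F) F]
          ((ι → AdeleRing (𝓞 F) F) × (ι → AdeleRing (𝓞 F) F))) w)
    (harch : ∀ (k : UnitaryGroup.finAdelic F₁ E c N J) (a w : ι → mixedSpace F),
      (adelicMpCont.proj F ι T (s k)).1 (archVec F ι a, archVec F ι w) = (archVec F ι a, archVec F ι w))
    (x₀ : A → ι → FiniteAdeleRing (𝓞 F) F) (𝔫 : Ideal (𝓞 F)) :
    ∃ 𝔪 : Ideal (𝓞 E), 𝔪 ≠ 0 ∧ ∀ a, ∀ k ∈ UnitaryGroup.finCongruenceLevel F₁ E c N J 𝔪,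
      finRepMp hT s harch k (cosetIndicatorSB F ι (x₀ a) 𝔫) =
        ((finRepMp hT s harch k (indicatorSB F ι (piLevelIdeal F ι 𝔫) (isOpen_piLevelIdeal F 𝔫)
            (isCompact_piLevelIdeal F ι 𝔫)) : FinSB F ι) : (ι → FiniteAdeleRing (𝓞 F) F) → ℂ) 0 •
          cosetIndicatorSB F ι (x₀ a) 𝔫 := by
  have hev : ∀ᶠ k in 𝓝 (1 : UnitaryGroup.finAdelic F₁ E c N J), ∀ a,
      finRepMp hT s harch k (cosetIndicatorSB F ι (x₀ a) 𝔫) =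
        ((finRepMp hT s harch k (indicatorSB F ι (piLevelIdeal F ι 𝔫) (isOpen_piLevelIdeal F 𝔫)
            (isCompact_piLevelIdeal F ι 𝔫)) : FinSB F ι) : (ι → FiniteAdeleRing (𝓞 F) F) → ℂ) 0 •
          cosetIndicatorSB F ι (x₀ a) 𝔫 :=
    Filter.eventually_all.2 fun a => eventually_finRepMp_cosetIndicatorSB_eq_smul_of_proj hT s hsc harch (x₀ a) 𝔫
  obtain ⟨𝔪, h𝔪, hsub⟩ := UnitaryGroup.exists_finCongruenceLevel_subset hev
  exact ⟨𝔪, h𝔪, fun a k hk => hsub hk a⟩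

/-- **LEVEL EIGENVECTORS.**  For a homomorphism `s : U(J)(𝔸_{E,f}) →* Mp_ψ(W_𝔸)ᶜᵒⁿᵗ` whose symplectic projections are
orbit-continuous and fix the archimedean vectors — in particular for the `U(J)`-member of a bare COMPATIBLE splitting of a
dual pair — EVERY `v ∈ 𝒮((𝔸_F^∞)^ι)` is an eigenvector of `ω_f(k)` for all `k` in some principal congruence level `K_{U,f}(𝔪)`,
`𝔪 ≠ 0`: `ω_f(k) v = c(k) · v` with `c(k) = (ω_f(k) 𝟙_{𝔫𝒪̂^ι})(0)`, `𝔫` a level of `v` (coset decomposition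
`v = Σ_q v(q) 𝟙_{q+𝔫𝒪̂^ι}`, `exists_eq_sum_smul_finTranslateSB_indicatorSB`, and the common eigenvalue above).
[cite: GelbartRogawski1991, §3.1 p. 454] [cite: Weil1964, Chap. III n° 37–39 pp. 188–190] -/
theorem exists_finCongruenceLevel_forall_finRepMp_eq_smul_of_proj (hT : IsUnit T)
    (s : UnitaryGroup.finAdelic F₁ E c N J →* adelicMpCont F ι T)
    (hsc : ∀ w : (ι → AdeleRing (𝓞 F) F) × (ι → AdeleRing (𝓞 F) F), Continuous fun z : UnitaryGroup.finAdelic F₁ E c N J =>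
      ((adelicMpCont.proj F ι T (s z) : symplecticGroup (polar (adelicForm F ι T))) :
        ((ι → AdeleRing (𝓞 F) F) × (ι → AdeleRing (𝓞 F) F)) ≃ₗ[AdeleRing (𝓞 F) F]
          ((ι → AdeleRing (𝓞 F) F) × (ι → AdeleRing (𝓞 F) F))) w)
    (harch : ∀ (k : UnitaryGroup.finAdelic F₁ E c N J) (a w : ι → mixedSpace F),
      (adelicMpCont.proj F ι T (s k)).1 (archVec F ι a, archVec F ι w) = (archVec F ι a, archVec F ι w))
    (v : FinSB F ι) :
    ∃ 𝔪 : Ideal (𝓞 E), 𝔪 ≠ 0 ∧ ∃ 𝔫 : Ideal (𝓞 F), ∀ k ∈ UnitaryGroup.finCongruenceLevel F₁ E c N J 𝔪,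
      finRepMp hT s harch k v =
        ((finRepMp hT s harch k (indicatorSB F ι (piLevelIdeal F ι 𝔫) (isOpen_piLevelIdeal F 𝔫)
            (isCompact_piLevelIdeal F ι 𝔫)) : FinSB F ι) : (ι → FiniteAdeleRing (𝓞 F) F) → ℂ) 0 • v := by
  classical
  -- a level of `v` and its coset decomposition
  obtain ⟨𝔫, -, hlev⟩ := exists_level_of_mem_schwartzBruhat F v.2
  obtain ⟨S, hS⟩ := exists_eq_sum_smul_finTranslateSB_indicatorSB (piLevelIdeal F ι 𝔫) (isOpen_piLevelIdeal F 𝔫)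
    (isCompact_piLevelIdeal F ι 𝔫) v hlev
  -- ONE principal congruence level for the finitely many coset indicators
  obtain ⟨𝔪, h𝔪, heig⟩ := exists_finCongruenceLevel_forall_forall_finRepMp_cosetIndicatorSB_eq_smul_of_proj (A := ↥S) hT s
    hsc harch (fun q => (q.1.out : ι → FiniteAdeleRing (𝓞 F) F)) 𝔫
  refine ⟨𝔪, h𝔪, 𝔫, fun k hk => ?_⟩
  have hS' : v = ∑ q ∈ S, ((v : (ι → FiniteAdeleRing (𝓞 F) F) → ℂ) q.out) •
      cosetIndicatorSB F ι (q.out : ι → FiniteAdeleRing (𝓞 F) F) 𝔫 := hS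
  conv_lhs => rw [hS']
  rw [map_sum]
  conv_rhs => rw [hS']
  rw [Finset.smul_sum]
  exact Finset.sum_congr rfl fun q hq => by rw [map_smul, heig ⟨q, hq⟩ k hk, smul_comm]

end Unitary

end Literature.NumberTheory.Weil1964

end
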